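import Summits.QuantumFields.YangMills.Theorems.SwapVirialDeficitBlowUpGnomonicZSignLargeField
import Summits.QuantumFields.YangMills.Theorems.SwapVirialDeficitBlowUpSignPatternsLargeField
import Summits.QuantumFields.YangMills.Theorems.SwapVirialDeficitGnomonicTaylorTrChart
import Summits.QuantumFields.YangMills.Theorems.SwapVirialDeficitSectorLaplaceDefs
import HarnessLib

/-!
# BAD SIGN PATTERNS ARE LARGE FIELD IN THE TRANSLATED SECTOR-001 CHART: `¬GoodSign ε ⟹ 1/(900·L⁶) ≤ F̂ʲ_{z₁,a,ε}(η)` at every hub `a ≠ 0`, hence the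
# pointwise floor `9L⁴ − 3/2 + 1/8 ≤ b·trGnoDeficit uJ z₁ (sectorChar z₁) a ε η` on `b ≥ 8100·L¹⁰` — STUB `stub_h001_bad` OF SKELETON ➎ (v5) BY NAME
# (free-hands support of ⟨stmt-QuantumFields-24197⟩ `SwapVirialDeficit.SwapGluedStiffness`; cell ym-idea-1, fcl-p3 g47's HOME `fcl-p3-g47-SectorStiffnessSkeleton.lean`,
# LEAD sfw-p2 g99 referee 2026-08-31 20:41Z: `χ = sectorChar z₁`, `Good = GoodSign`, null-hub guards `a.re ≠ 0`, `a.im ≠ 0`)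

The twin, for sector `001` read in the translated chart ✓`trGnoDeficit u z χ a ε η = chartDeficit L z χ (blowUpPoint 1 (trGnomonicPoint u a ε η))` (✓`…TranslatedDefs`;
`C₂ = Q(u·ŷ)`, the other leaders and all followers unchanged: ✓`Gnomonic.trLeader_eq_of_ne_two`, ✓`Gnomonic.trFollower_eq`), of this seat-line's ✓`badSign_floor`
(✓`…ZSignLargeField`, sector `000`).  A sign pattern that is NOT good has either the σ-slaving letter on the `−` hemisphere (`ε.2.1 = false`) or some follower there:
* §1 ★ `chartDeficit_twisted_ge_of_sigmaRel_far (z) (q) (μ)` — separation in a SIGNED σ-relation, every sector: `0 ≤ R ≤ ‖c·C_{σμ} − centreElem(z μ)·C_μ·c‖_F ⟹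
  R²/(2704·L⁶) ≤ F̂_z` (second conjunct of w3 g65's ✓`chartBox_of_chartDeficit_twisted`, `52L³√F̂_z`);
* §2 for a sector with `z 0 = false` (both even sectors `z₀`, `z₁`) the `μ = 0` signed relation is UNTWISTED (`centreElem (z 0) = 1`), and in the translated chart its
  three leaders `c, C₁, C₀` are the master ones, so ✓`two_le_fd_sigmaRel_zero_of_zSign_false` transfers: ★ `two_le_fd_trSigmaRel_zero_of_zSign_false`;
* §3 ★★ `trGnoDeficit_ge_of_zSign_false (u) (z) (hz0 : z 0 = false) (ha : a ≠ 0) (ε) (hε : ε.2.1 = false) (η) : 1/(676·L⁶) ≤ trGnoDeficit u z (sectorChar z) a ε η`,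
  ★★ `trGnoDeficit_ge_of_follower_sign_false (u z a ε η) (hi : ε.2.2 i = false) : 1/(576·L⁶) ≤ …` (every sector, every hub, every translation),
  ★★★ `trGnoDeficit_ge_of_not_goodSign` (`1/(900·L⁶)`), the Boltzmann form `exp_neg_mul_trGnoDeficit_le_of_not_goodSign`;
* §4 (namespace `…SectorLaplace`) ★★ `trBadSign_floor (u)` (`∃ c > 0, … c/L⁶ ≤ trGnoDeficit u z₁ (sectorChar z₁) a ε η`) and ★★★ `h001_bad` = THE STUB `stub_h001_bad`
  LITERALLY (`K = 8100`, `q = 10`: `b ≥ 8100·L¹⁰ ⟹ b/(900L⁶) ≥ 9L⁴ ≥ 9L⁴ − 3/2 + 1/8`).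
What is NOT here: the good-pattern stub `stub_h001_good` (the 001 fibred Laplace law), `stub_B_stiff`, `stub_core_weight`.

HONEST LABEL: bookkeeping on landed inequalities (one stub of a four-stub skeleton); ⟨24197⟩ ∕ ⟨24194⟩ OPEN; own crux ⟨22884⟩ `LargeFieldMassRefinementTail` OPEN
(blocked-on ⟨19935⟩); no crux, rung of record or summit is proved; the Yang–Mills mass gap is NOT proved; no summit is proved by a line.  THEOREMS ONLY (0 `def`,
0 `sorry`), standard axioms.  Width seat ym-line-sfw-p2-w3 g67 (cell ym-idea-1, free hands), `--supports stmt-QuantumFields-24197`.  References: [cite: tHooft1979];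
[cite: Luscher1983, §2]; [folklore].
-/

set_option autoImplicit false

noncomputable section

open MeasureTheory Quaternion
open scoped BigOperators Quaternion
open Literature.MathematicalPhysics.QuantumFieldTheory hiding SU2
open Literature.MathematicalPhysics.QuantumLattice

namespace Summit.QuantumFields.YangMills.Theorems.SwapVirialDeficit.BlowUpRing

open Summit.QuantumFields.YangMills.Theorems.FemtoTransferGap
open Summit.QuantumFields.YangMills.Theorems.FemtoTransferGap.TT
open Summit.QuantumFields.YangMills.Theorems.VirialFluxGap.RingDeficit
open Summit.QuantumFields.YangMills.Theorems.SwapVirialDeficit.SwapRing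
open Summit.QuantumFields.YangMills.Theorems.SwapVirialDeficit.Gnomonic (trLeader_eq_of_ne_two trFollower_eq)
open Summit.QuantumFields.YangMills.Theorems.SwapVirialDeficit.SectorLaplace (z₀ z₁ uJ sectorChar sectorChar_eq GoodSign)

variable {L : ℕ} [NeZero L]

/-! ## §1 Separation in a signed σ-relation, every sector -/

/-- ★ **Separation in a SIGNED σ-relation, every sector `z`**: `0 ≤ R ≤ ‖c·C_{σμ} − centreElem(z μ)·C_μ·c‖_F ⟹ R²/(2704·L⁶) ≤ F̂_z(C,U)`
(`F̂_z = chartDeficit L z χ_z`, `χ_z = sectorChar z`; ✓`chartBox_of_chartDeficit_twisted`). [cite: tHooft1979] [cite: Luscher1983, §2] -/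
theorem chartDeficit_twisted_ge_of_sigmaRel_far (z : Fin 3 → Bool) (q : (Fin 4 → SU2) × (Fol L → SU2)) (μ : Fin 3) {R : ℝ} (hR : 0 ≤ R)
    (hfar : R ≤ frobNorm (((q.1 (Fin.last 3) * q.1 (Fin.castSucc (Equiv.swap (0 : Fin 3) 1 μ)) : SU2) : Matrix (Fin 2) (Fin 2) ℂ) -
        ((centreElem (z μ) * q.1 (Fin.castSucc μ) * q.1 (Fin.last 3) : SU2) : Matrix (Fin 2) (Fin 2) ℂ))) :
    R ^ 2 / (2704 * (L : ℝ) ^ 6) ≤ chartDeficit L z (sectorChar z) q := by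
  rw [sectorChar_eq]
  obtain ⟨-, hσ, -⟩ := chartBox_of_chartDeficit_twisted (L := L) z q
  have hL : (0 : ℝ) < L := by exact_mod_cast NeZero.pos L
  have h := div_sq_le_of_le_of_le_mul_sqrt hR (by positivity : (0 : ℝ) < 52 * (L : ℝ) ^ 3) (chartDeficit_nonneg z _ q) hfar (hσ μ)
  calc R ^ 2 / (2704 * (L : ℝ) ^ 6) = R ^ 2 / (52 * (L : ℝ) ^ 3) ^ 2 := by ring
    _ ≤ _ := h

/-- ★ Separation in a follower direction, every sector, with the sector character by name: `0 ≤ R ≤ ‖U_i − 1‖_F ⟹ R²/(2304·L⁶) ≤ chartDeficit L z (sectorChar z) q`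
(✓`chartDeficit_twisted_ge_of_follower_far`). [cite: Luscher1983, §2] -/
theorem chartDeficit_sectorChar_ge_of_follower_far (z : Fin 3 → Bool) (q : (Fin 4 → SU2) × (Fol L → SU2)) (i : Fol L) {R : ℝ} (hR : 0 ≤ R)
    (hfar : R ≤ frobNorm (((q.2 i : SU2) : Matrix (Fin 2) (Fin 2) ℂ) - 1)) :
    R ^ 2 / (2304 * (L : ℝ) ^ 6) ≤ chartDeficit L z (sectorChar z) q := by
  rw [sectorChar_eq]
  exact chartDeficit_twisted_ge_of_follower_far z q i hR hfar

/-! ## §2 Sectors with `z 0 = false`: the `μ = 0` relation is untwisted, and in the translated chart it is the master one -/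

omit [NeZero L] in
/-- In a sector with `z 0 = false` the `μ = 0` signed σ-relation defect of ANY chart point is the plain one: `centreElem (z 0) = 1`. [cite: tHooft1979] -/
theorem signedSigmaRel_zero_eq_of_z0_false (z : Fin 3 → Bool) (hz0 : z 0 = false) (q : (Fin 4 → SU2) × (Fol L → SU2)) :
    ((centreElem (z 0) * q.1 (Fin.castSucc 0) * q.1 (Fin.last 3) : SU2) : Matrix (Fin 2) (Fin 2) ℂ) =
      ((q.1 (Fin.castSucc 0) * q.1 (Fin.last 3) : SU2) : Matrix (Fin 2) (Fin 2) ℂ) := by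
  rw [hz0, show centreElem false = (1 : SU2) from rfl, one_mul]

omit [NeZero L] in
/-- ★ The `μ = 0` σ-relation defect of the TRANSLATED point equals that of the master point (its three leaders `c = C₃`, `C_{σ0} = C₁`, `C₀` are untouched by the
translation of the `y`-letter, ✓`trLeader_eq_of_ne_two`). [folklore] -/
theorem fd_trSigmaRel_zero_eq (u a : ℍ) (ε : GnoSign L) (η : GnoCoord L) :
    frobNorm ((((blowUpPoint (L := L) 1 (trGnomonicPoint u a ε η)).1 (Fin.last 3) *
        (blowUpPoint (L := L) 1 (trGnomonicPoint u a ε η)).1 (Fin.castSucc (Equiv.swap (0 : Fin 3) 1 0)) : SU2) : Matrix (Fin 2) (Fin 2) ℂ) -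
        (((blowUpPoint (L := L) 1 (trGnomonicPoint u a ε η)).1 (Fin.castSucc 0) * (blowUpPoint (L := L) 1 (trGnomonicPoint u a ε η)).1 (Fin.last 3) : SU2) :
          Matrix (Fin 2) (Fin 2) ℂ)) =
    frobNorm ((((blowUpPoint (L := L) 1 (gnomonicPoint a ε η)).1 (Fin.last 3) *
        (blowUpPoint (L := L) 1 (gnomonicPoint a ε η)).1 (Fin.castSucc (Equiv.swap (0 : Fin 3) 1 0)) : SU2) : Matrix (Fin 2) (Fin 2) ℂ) -
        (((blowUpPoint (L := L) 1 (gnomonicPoint a ε η)).1 (Fin.castSucc 0) * (blowUpPoint (L := L) 1 (gnomonicPoint a ε η)).1 (Fin.last 3) : SU2) :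
          Matrix (Fin 2) (Fin 2) ℂ)) := by
  have h3 : (Fin.last 3 : Fin 4) ≠ 2 := by decide
  have h1 : (Fin.castSucc (Equiv.swap (0 : Fin 3) 1 0) : Fin 4) ≠ 2 := by rw [Equiv.swap_apply_left]; decide
  have h0 : (Fin.castSucc (0 : Fin 3) : Fin 4) ≠ 2 := by decide
  rw [trLeader_eq_of_ne_two u a ε η h3, trLeader_eq_of_ne_two u a ε η h1, trLeader_eq_of_ne_two u a ε η h0]

omit [NeZero L] in
/-- ★ **For `ε_z = false` the `μ = 0` signed σ-relation defect of the translated point is `≥ 2`** in every sector with `z 0 = false`, at every hub `a ≠ 0`, for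
every translation `u` (✓`two_le_fd_sigmaRel_zero_of_zSign_false` transferred). [cite: Luscher1983, §2] -/
theorem two_le_fd_trSigmaRel_zero_of_zSign_false (u : ℍ) (z : Fin 3 → Bool) (hz0 : z 0 = false) {a : ℍ} (ha : a ≠ 0) (ε : GnoSign L)
    (hε : ε.2.1 = false) (η : GnoCoord L) :
    2 ≤ frobNorm ((((blowUpPoint (L := L) 1 (trGnomonicPoint u a ε η)).1 (Fin.last 3) *
        (blowUpPoint (L := L) 1 (trGnomonicPoint u a ε η)).1 (Fin.castSucc (Equiv.swap (0 : Fin 3) 1 0)) : SU2) : Matrix (Fin 2) (Fin 2) ℂ) -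
        ((centreElem (z 0) * (blowUpPoint (L := L) 1 (trGnomonicPoint u a ε η)).1 (Fin.castSucc 0) *
          (blowUpPoint (L := L) 1 (trGnomonicPoint u a ε η)).1 (Fin.last 3) : SU2) : Matrix (Fin 2) (Fin 2) ℂ)) := by
  rw [signedSigmaRel_zero_eq_of_z0_false z hz0, fd_trSigmaRel_zero_eq u a ε η]
  exact two_le_fd_sigmaRel_zero_of_zSign_false ha ε hε η

/-! ## §3 Translated-chart level: bad sign patterns are uniformly large field -/

/-- ★★ **THE NEGATIVE `z`-HEMISPHERE IS LARGE FIELD IN THE TRANSLATED CHART** (every sector with `z 0 = false`, every translation `u`):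
`ε_z = false ⟹ 1/(676·L⁶) ≤ trGnoDeficit u z (sectorChar z) a ε η` for every hub `a ≠ 0`, all other signs and ALL coordinates `η`. [cite: Luscher1983, §2] -/
theorem trGnoDeficit_ge_of_zSign_false (u : ℍ) (z : Fin 3 → Bool) (hz0 : z 0 = false) {a : ℍ} (ha : a ≠ 0) (ε : GnoSign L) (hε : ε.2.1 = false)
    (η : GnoCoord L) : 1 / (676 * (L : ℝ) ^ 6) ≤ trGnoDeficit u z (sectorChar z) a ε η := by
  unfold trGnoDeficit
  have h := chartDeficit_twisted_ge_of_sigmaRel_far (L := L) z (blowUpPoint (L := L) 1 (trGnomonicPoint u a ε η)) 0 (R := 2) (by norm_num)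
    (two_le_fd_trSigmaRel_zero_of_zSign_false u z hz0 ha ε hε η)
  calc 1 / (676 * (L : ℝ) ^ 6) = 2 ^ 2 / (2704 * (L : ℝ) ^ 6) := by ring
    _ ≤ _ := h

/-- ★★ **NON-PLUS FOLLOWER PATTERNS ARE LARGE FIELD IN THE TRANSLATED CHART** (every sector, every hub, every translation): `ε.2.2 i = false ⟹
1/(576·L⁶) ≤ trGnoDeficit u z (sectorChar z) a ε η`. [cite: Luscher1983, §2] -/
theorem trGnoDeficit_ge_of_follower_sign_false (u : ℍ) (z : Fin 3 → Bool) (a : ℍ) (ε : GnoSign L) (η : GnoCoord L) {i : Fol L} (hi : ε.2.2 i = false) :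
    1 / (576 * (L : ℝ) ^ 6) ≤ trGnoDeficit u z (sectorChar z) a ε η := by
  unfold trGnoDeficit
  rw [sectorChar_eq]
  refine chartDeficit_twisted_ge_of_follower_sign_false (L := L) z _ i (η.2.2 i) ?_
  rw [trFollower_eq, blowUpPoint_one_gnomonicPoint_snd, hi]

/-- ★★★ **BAD SIGN PATTERNS ARE UNIFORMLY LARGE FIELD IN THE TRANSLATED CHART** (every sector with `z 0 = false`, in particular `z₁ = 001`; every translation `u`):
a pattern that is not good (`¬(ε_z = + ∧ all followers +)`) has `1/(900·L⁶) ≤ trGnoDeficit u z (sectorChar z) a ε η` at every hub `a ≠ 0` and all `η`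
(`min (1/676) (1/576) ≥ 1/900`). [cite: Luscher1983, §2] -/
theorem trGnoDeficit_ge_of_not_goodSign (u : ℍ) (z : Fin 3 → Bool) (hz0 : z 0 = false) {a : ℍ} (ha : a ≠ 0) (ε : GnoSign L) (h : ¬ GoodSign ε)
    (η : GnoCoord L) : 1 / (900 * (L : ℝ) ^ 6) ≤ trGnoDeficit u z (sectorChar z) a ε η := by
  have hL : (0 : ℝ) < L := by exact_mod_cast NeZero.pos L
  by_cases hz : ε.2.1 = true
  · have hF : ¬ (ε.2.2 = fun _ => true) := fun hF => h ⟨hz, hF⟩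
    obtain ⟨i, hi⟩ : ∃ i, ε.2.2 i = false := by
      by_contra hne
      exact hF (funext fun i => by
        cases hi : ε.2.2 i
        · exact absurd ⟨i, hi⟩ hne
        · rfl)
    calc 1 / (900 * (L : ℝ) ^ 6) ≤ 1 / (576 * (L : ℝ) ^ 6) := by
          apply one_div_le_one_div_of_le (by positivity); nlinarith [pow_pos hL 6]
      _ ≤ _ := trGnoDeficit_ge_of_follower_sign_false u z a ε η hi
  · calc 1 / (900 * (L : ℝ) ^ 6) ≤ 1 / (676 * (L : ℝ) ^ 6) := by
          apply one_div_le_one_div_of_le (by positivity); nlinarith [pow_pos hL 6]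
      _ ≤ _ := trGnoDeficit_ge_of_zSign_false u z hz0 ha ε (by simpa using hz) η

/-- ★ **The Boltzmann factor of a bad pattern in the translated chart**: `e^{−b·F̂ʲ} ≤ e^{−b/(900·L⁶)}` for `b ≥ 0` (every sector with `z 0 = false`, every hub
`a ≠ 0`) — the large-field share of the sector-001 sign sum. [cite: Luscher1983, §2] -/
theorem exp_neg_mul_trGnoDeficit_le_of_not_goodSign (u : ℍ) (z : Fin 3 → Bool) (hz0 : z 0 = false) {a : ℍ} (ha : a ≠ 0) (ε : GnoSign L)
    (h : ¬ GoodSign ε) (η : GnoCoord L) {b : ℝ} (hb : 0 ≤ b) :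
    Real.exp (-(b * trGnoDeficit u z (sectorChar z) a ε η)) ≤ Real.exp (-(b / (900 * (L : ℝ) ^ 6))) := by
  have hf := trGnoDeficit_ge_of_not_goodSign (L := L) u z hz0 ha ε h η
  rw [Real.exp_le_exp, neg_le_neg_iff]
  calc b / (900 * (L : ℝ) ^ 6) = b * (1 / (900 * (L : ℝ) ^ 6)) := by ring
    _ ≤ _ := mul_le_mul_of_nonneg_left hf hb

/-- `z₁ 0 = false`: sector `001` twists only across the plane `k = 2`. [cite: tHooft1979] -/
theorem z₁_zero : z₁ 0 = false := by decide

/-- `z₀ 0 = false`. [cite: tHooft1979] -/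
theorem z₀_zero : z₀ 0 = false := rfl

/-- ★★ Sector `001`, translated by `uJ = j`, by name: `¬GoodSign ε ⟹ 1/(900·L⁶) ≤ trGnoDeficit uJ z₁ (sectorChar z₁) a ε η` at every hub `a ≠ 0`. [cite: Luscher1983, §2] -/
theorem trGnoDeficit_z₁_ge_of_not_goodSign {a : ℍ} (ha : a ≠ 0) (ε : GnoSign L) (h : ¬ GoodSign ε) (η : GnoCoord L) :
    1 / (900 * (L : ℝ) ^ 6) ≤ trGnoDeficit uJ z₁ (sectorChar z₁) a ε η :=
  trGnoDeficit_ge_of_not_goodSign uJ z₁ z₁_zero ha ε h η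

end Summit.QuantumFields.YangMills.Theorems.SwapVirialDeficit.BlowUpRing

/-! ## §4 The packaged forms for skeleton ➎: the 001 bad-sign floor and STUB `stub_h001_bad` literally -/

namespace Summit.QuantumFields.YangMills.Theorems.SwapVirialDeficit.SectorLaplace

open Summit.QuantumFields.YangMills.Theorems.FemtoTransferGap
open Summit.QuantumFields.YangMills.Theorems.FemtoTransferGap.TT
open Summit.QuantumFields.YangMills.Theorems.VirialFluxGap.RingDeficit
open Summit.QuantumFields.YangMills.Theorems.SwapVirialDeficit.SwapRing
open Summit.QuantumFields.YangMills.Theorems.SwapVirialDeficit.BlowUpRing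

/-- ★★ **THE 001 BAD-SIGN FLOOR** (twin of ✓`badSign_floor`): one absolute constant `c = 1/900` such that for every `L`, every hub `a ≠ 0`, every sign pattern
that is NOT good and every `η`, `c/L⁶ ≤ trGnoDeficit u z₁ (sectorChar z₁) a ε η` — for EVERY translation `u` (the skeleton takes `u = uJ`). [cite: Luscher1983, §2] -/
theorem trBadSign_floor (u : ℍ) : ∃ c : ℝ, 0 < c ∧ ∀ (L : ℕ) [NeZero L] (a : ℍ), a ≠ 0 → ∀ ε : GnoSign L, ¬ GoodSign ε →
    ∀ η : GnoCoord L, c / (L : ℝ) ^ 6 ≤ trGnoDeficit u z₁ (sectorChar z₁) a ε η := by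
  refine ⟨1 / 900, by norm_num, fun L _ a ha ε hε η => ?_⟩
  have h := trGnoDeficit_ge_of_not_goodSign (L := L) u z₁ z₁_zero ha ε hε η
  calc 1 / 900 / (L : ℝ) ^ 6 = 1 / (900 * (L : ℝ) ^ 6) := by ring
    _ ≤ _ := h

/-- ★★★ **STUB `stub_h001_bad` OF SKELETON ➎ (v5), LITERALLY**: sector `001`, BAD sign patterns, the pointwise large-field floor `κ_L ≤ b·F̂ʲ_{z₁,a,ε}(η)`
above the polynomial threshold `b ≥ 8100·L¹⁰`, at every hub with `a.re ≠ 0`, `a.im ≠ 0` (indeed at every `a ≠ 0`):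
`b·F̂ʲ ≥ 8100L¹⁰/(900L⁶) = 9L⁴ ≥ 9L⁴ − 3/2 + 1/8`. [cite: Luscher1983, §2] -/
theorem h001_bad : ∃ K : ℝ, 0 < K ∧ ∃ q : ℕ, ∀ (L : ℕ) [NeZero L] (b : ℝ), K * (L : ℝ) ^ q ≤ b →
    ∀ a : ℍ, a.re ≠ 0 → a.im ≠ 0 → ∀ ε : GnoSign L, ¬ GoodSign ε → ∀ η : GnoCoord L,
      9 * (L : ℝ) ^ 4 - 3 / 2 + 1 / 8 ≤ b * trGnoDeficit uJ z₁ (sectorChar z₁) a ε η := by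
  refine ⟨8100, by norm_num, 10, fun L _ b hb a hre _ ε hε η => ?_⟩
  have ha : a ≠ 0 := fun h => hre (by rw [h]; rfl)
  have hL : (0 : ℝ) < L := by exact_mod_cast NeZero.pos L
  have hL6 : (0 : ℝ) < (L : ℝ) ^ 6 := pow_pos hL 6
  have hb0 : 0 ≤ b := le_trans (by positivity) hb
  have hf := trGnoDeficit_z₁_ge_of_not_goodSign (L := L) ha ε hε η
  have h1 : b * (1 / (900 * (L : ℝ) ^ 6)) ≤ b * trGnoDeficit uJ z₁ (sectorChar z₁) a ε η := mul_le_mul_of_nonneg_left hf hb0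
  have h2 : 9 * (L : ℝ) ^ 4 ≤ b * (1 / (900 * (L : ℝ) ^ 6)) := by
    rw [mul_one_div, le_div_iff₀ (by positivity)]
    calc 9 * (L : ℝ) ^ 4 * (900 * (L : ℝ) ^ 6) = 8100 * (L : ℝ) ^ 10 := by ring
      _ ≤ b := hb
  linarith

/-- ★ The same floor at EVERY hub `a ≠ 0` (no null-hub guard needed) and for every translation `u`. [cite: Luscher1983, §2] -/
theorem h001_bad_of_ne_zero (u : ℍ) : ∃ K : ℝ, 0 < K ∧ ∃ q : ℕ, ∀ (L : ℕ) [NeZero L] (b : ℝ), K * (L : ℝ) ^ q ≤ b →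
    ∀ a : ℍ, a ≠ 0 → ∀ ε : GnoSign L, ¬ GoodSign ε → ∀ η : GnoCoord L,
      9 * (L : ℝ) ^ 4 - 3 / 2 + 1 / 8 ≤ b * trGnoDeficit u z₁ (sectorChar z₁) a ε η := by
  refine ⟨8100, by norm_num, 10, fun L _ b hb a ha ε hε η => ?_⟩
  have hL : (0 : ℝ) < L := by exact_mod_cast NeZero.pos L
  have hL6 : (0 : ℝ) < (L : ℝ) ^ 6 := pow_pos hL 6
  have hb0 : 0 ≤ b := le_trans (by positivity) hb
  have hf := trGnoDeficit_ge_of_not_goodSign (L := L) u z₁ z₁_zero ha ε hε η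
  have h1 : b * (1 / (900 * (L : ℝ) ^ 6)) ≤ b * trGnoDeficit u z₁ (sectorChar z₁) a ε η := mul_le_mul_of_nonneg_left hf hb0
  have h2 : 9 * (L : ℝ) ^ 4 ≤ b * (1 / (900 * (L : ℝ) ^ 6)) := by
    rw [mul_one_div, le_div_iff₀ (by positivity)]
    calc 9 * (L : ℝ) ^ 4 * (900 * (L : ℝ) ^ 6) = 8100 * (L : ℝ) ^ 10 := by ring
      _ ≤ b := hb
  linarith

end Summit.QuantumFields.YangMills.Theorems.SwapVirialDeficit.SectorLaplace

end
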